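import Mathlib
import Literature.Analysis.FluidPDE.LagrangianLatticeCarrier

/-!
# Sketch — crux idea `distortion-trapping-ceiling` (K3L `LagrangianCarrierConstruction`, stmt-AnomalousDissipation-24913; lens «control»)

Typed objects of the card (planner ad-ideate-p4 g6, 2026-08-28). Everything over the tree structure
`Literature.Analysis.FluidPDE.LatticeShear.LagrangianLatticeCarrier` (fields `flowDeriv`, `window`, `refresh`, `strain`, `N`).

* `FrameDistortionLe E m d`  — the level-`m` FRAME DISTORTION over the level-`(m+1)` refresh windows is `≤ d`
  (`‖DX_m(t, w_j) − I‖ ≤ d`, `w_j = j · refresh (m+1)`, `t ∈ window (m+1) j`; advisory R23-2's D1′ at one level).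
* `FrameCurvatureLe E m K` — the level-`m` frame is `K · N_m`-Lipschitz in the base point over the same windows (normalised CURVATURE).
* `DistortionStep E κ p`   — the ONE-LEVEL CONJUGATION ESTIMATE (the card's First lemma, to be proved from `IsLagrangian`, the eleven
  qualitative clauses, (W2) and the chain rule): if all coarser frames have distortion `≤ D` and curvature `≤ Kc`, the level-`m` frame has
  distortion and curvature `≤ κ (1+D)^p (1+Kc) · strain m` (the Eulerian level-`i` increments over a fine window, of total size
  `≲ Σ_{i≤m} a_i · refresh (m+1) = strain m`, conjugated by frames of distortion `≤ D`).
* `trap₂` (PROVED) — the controlling-quantity statement: the region `{D ≤ 1/2, Kc ≤ 1/2}` is invariant under the step as soon as the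
  strain budgets satisfy the CEILING `κ (3/2)^(p+1) · strain m ≤ 1/2` for every `m`; with (S) `strain m ≤ θ (m+1)` and (T4) this is a
  smallness condition on `θ₀` — uniform in `m`, using NO separation decay. `trap₁` is the one-component version.
-/

namespace Summit.AnomalousDissipation.AnomalousDissipation.Cruxes.LagrangianCarrierConstruction.DistortionTrap

open Literature.Analysis.FluidPDE.LatticeShear

variable {k : ℕ}

/-- Level-`m` frame distortion over the level-`(m+1)` refresh windows is at most `d`. -/
def FrameDistortionLe (E : LagrangianLatticeCarrier k) (m : ℕ) (d : ℝ) : Prop :=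
  ∀ j : ℤ, ∀ t ∈ E.window (m + 1) j, ∀ y,
    ‖E.flowDeriv m t ((j : ℝ) * E.refresh (m + 1)) y - ContinuousLinearMap.id ℝ (EuclideanSpace ℝ (Fin 3))‖ ≤ d

/-- Level-`m` frame curvature (Lipschitz constant of `y ↦ DX_m(t, w_j) y`, normalised by `N_m`) over the level-`(m+1)` windows is at most `K`. -/
def FrameCurvatureLe (E : LagrangianLatticeCarrier k) (m : ℕ) (K : ℝ) : Prop :=
  ∀ j : ℤ, ∀ t ∈ E.window (m + 1) j, ∀ y y',
    ‖E.flowDeriv m t ((j : ℝ) * E.refresh (m + 1)) y - E.flowDeriv m t ((j : ℝ) * E.refresh (m + 1)) y'‖ ≤ K * (E.N m : ℝ) * dist y y'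

/-- The one-level conjugation estimate with constants `κ, p` (First lemma of the card; `κ ≍ 3√3·k` from `lipschitzWith_lift_level`). -/
def DistortionStep (E : LagrangianLatticeCarrier k) (κ : ℝ) (p : ℕ) : Prop :=
  ∀ (m : ℕ) (D Kc : ℝ), 0 ≤ D → 0 ≤ Kc →
    (∀ i < m, FrameDistortionLe E i D ∧ FrameCurvatureLe E i Kc) →
      FrameDistortionLe E m (κ * (1 + D) ^ p * (1 + Kc) * E.strain m) ∧
        FrameCurvatureLe E m (κ * (1 + D) ^ p * (1 + Kc) * E.strain m)

/-- One-component version (distortion only, exponent `p`). -/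
def DistortionStep₁ (E : LagrangianLatticeCarrier k) (κ : ℝ) (p : ℕ) : Prop :=
  ∀ (m : ℕ) (D : ℝ), 0 ≤ D → (∀ i < m, FrameDistortionLe E i D) → FrameDistortionLe E m (κ * (1 + D) ^ p * E.strain m)

theorem FrameDistortionLe.mono {E : LagrangianLatticeCarrier k} {m : ℕ} {d d' : ℝ} (h : FrameDistortionLe E m d) (hd : d ≤ d') :
    FrameDistortionLe E m d' :=
  fun j t ht y => (h j t ht y).trans hd

theorem FrameCurvatureLe.mono {E : LagrangianLatticeCarrier k} {m : ℕ} {K K' : ℝ} (h : FrameCurvatureLe E m K) (hK : K ≤ K') :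
    FrameCurvatureLe E m K' :=
  fun j t ht y y' => (h j t ht y y').trans
    (mul_le_mul_of_nonneg_right (mul_le_mul_of_nonneg_right hK (by positivity)) dist_nonneg)

/-- **Trapping region, one component.** If the conjugation step holds and every strain budget is under the ceiling
`κ (3/2)^p · strain m ≤ 1/2`, then EVERY frame has distortion `≤ 1/2` (strong induction; no separation decay used). -/
theorem trap₁ {E : LagrangianLatticeCarrier k} {κ : ℝ} {p : ℕ} (hstep : DistortionStep₁ E κ p)
    (hceil : ∀ m, κ * (3 / 2 : ℝ) ^ p * E.strain m ≤ 1 / 2) : ∀ m, FrameDistortionLe E m (1 / 2) := by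
  intro m
  induction m using Nat.strong_induction_on with
  | _ m ih =>
    have h := hstep m (1 / 2) (by norm_num) fun i hi => ih i hi
    refine h.mono ?_
    have : κ * (1 + 1 / 2 : ℝ) ^ p * E.strain m = κ * (3 / 2 : ℝ) ^ p * E.strain m := by norm_num
    rw [this]
    exact hceil m

/-- **Trapping region, two components (distortion + normalised curvature).** Ceiling `κ (3/2)^(p+1) · strain m ≤ 1/2` for all `m`
⇒ every frame has distortion `≤ 1/2` and normalised curvature `≤ 1/2`. -/
theorem trap₂ {E : LagrangianLatticeCarrier k} {κ : ℝ} {p : ℕ} (hstep : DistortionStep E κ p)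
    (hceil : ∀ m, κ * (3 / 2 : ℝ) ^ (p + 1) * E.strain m ≤ 1 / 2) :
    ∀ m, FrameDistortionLe E m (1 / 2) ∧ FrameCurvatureLe E m (1 / 2) := by
  intro m
  induction m using Nat.strong_induction_on with
  | _ m ih =>
    have h := hstep m (1 / 2) (1 / 2) (by norm_num) (by norm_num) fun i hi => ih i hi
    have hb : κ * (1 + 1 / 2 : ℝ) ^ p * (1 + 1 / 2) * E.strain m ≤ 1 / 2 := by
      have : κ * (1 + 1 / 2 : ℝ) ^ p * (1 + 1 / 2) * E.strain m = κ * (3 / 2 : ℝ) ^ (p + 1) * E.strain m := by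
        have h32 : (1 + 1 / 2 : ℝ) = 3 / 2 := by norm_num
        rw [h32, pow_succ]; ring
      rw [this]; exact hceil m
    exact ⟨h.1.mono hb, h.2.mono hb⟩

/-- The ceiling from the stub's binders: (S) `strain m ≤ θ (m+1)`, (T4) `θ (m+1) · (N (m+1)/N m)^(1/16) ≤ θ₀` with `N m ≤ N (m+1)`, and the
proposed v8 binder `θ₀ ≤ θs` with `κ (3/2)^(p+1) θs ≤ 1/2` give the hypothesis of `trap₂`. -/
theorem ceiling_of_template {E : LagrangianLatticeCarrier k} {κ θ₀ θs : ℝ} {p : ℕ} (hκ : 0 ≤ κ)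
    (hS : ∀ m, E.strain m ≤ E.θ (m + 1)) (hmono : ∀ m, E.N m ≤ E.N (m + 1))
    (hT4 : ∀ m, E.θ (m + 1) * ((E.N (m + 1) : ℝ) / E.N m) ^ (1 / 16 : ℝ) ≤ θ₀) (hθ : ∀ m, 0 ≤ E.θ (m + 1))
    (hsmall : θ₀ ≤ θs) (hclose : κ * (3 / 2 : ℝ) ^ (p + 1) * θs ≤ 1 / 2) :
    ∀ m, κ * (3 / 2 : ℝ) ^ (p + 1) * E.strain m ≤ 1 / 2 := by
  intro m
  have hN : (0 : ℝ) < E.N m := by exact_mod_cast E.N_pos m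
  have hratio : (1 : ℝ) ≤ ((E.N (m + 1) : ℝ) / E.N m) ^ (1 / 16 : ℝ) :=
    Real.one_le_rpow ((one_le_div hN).2 (by exact_mod_cast hmono m)) (by norm_num)
  have hθle : E.θ (m + 1) ≤ θ₀ := by
    calc E.θ (m + 1) = E.θ (m + 1) * 1 := (mul_one _).symm
      _ ≤ E.θ (m + 1) * ((E.N (m + 1) : ℝ) / E.N m) ^ (1 / 16 : ℝ) := mul_le_mul_of_nonneg_left hratio (hθ m)
      _ ≤ θ₀ := hT4 m
  calc κ * (3 / 2 : ℝ) ^ (p + 1) * E.strain m ≤ κ * (3 / 2 : ℝ) ^ (p + 1) * θs :=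
        mul_le_mul_of_nonneg_left ((hS m).trans (hθle.trans hsmall)) (by positivity)
    _ ≤ 1 / 2 := hclose

end Summit.AnomalousDissipation.AnomalousDissipation.Cruxes.LagrangianCarrierConstruction.DistortionTrap
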